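import Summits.Ventures.HodgeRepro2.BergmanInvariant
import Summits.Ventures.HodgeRepro2.PeterssonCompact

/-!
# The Bergman measure on `𝔹²` descends to `Γ\𝔹²` through a fundamental domain

Kernel support for the blind cell pub-hodge-repro2 (seat p2), T5-ID §ID-4(b′).  Row 98
(`BergmanInvariant.lean`) proved that the Bergman measure `μ_B` on the ball is `U(2,1)`-invariant.  Here:

* `bergmanBall` = `μ_B` as a measure on the subtype `𝔹²`; it is invariant under the frame action of the
  arithmetic group `S` (`smulInvariantMeasure_bergmanBall`) and positive on open sets;
* given a measurable FUNDAMENTAL DOMAIN `D ⊆ 𝔹²` for `S` (Mathlib's `IsFundamentalDomain`; its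
  existence is the arithmetic input — properly discontinuous action — and stays a hypothesis), the
  push-forward `quotientMeasure hD := mk_*(μ_B|_D)` is a measure on `Γ\𝔹²` with Mathlib's
  `QuotientMeasureEqMeasurePreimage` property, whose integrals are integrals over `D`;
* `Γ\𝔹²` is `OpensMeasurableSpace`; `quotientMeasure hD` is positive on open sets, and finite when
  `μ_B(D) < ∞` — exactly the hypotheses under which `PeterssonInner.lean` proves the Petersson inner
  product positive definite.
-/

namespace Summit.Ventures.HodgeRepro2.ShimuraData

open MeasureTheory
open scoped Pointwise

/-- A number field is countable (it is a finite-dimensional `ℚ`-vector space). -/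
theorem countable_of_numberField (K : Type*) [Field K] [NumberField K] : Countable K :=
  (Module.finBasis ℚ K).equivFun.injective.countable

/-- `GL₃(K)` is countable for a number field `K`. -/
theorem countable_GL_of_numberField (K : Type*) [Field K] [NumberField K] : Countable (GL (Fin 3) K) := by
  haveI := countable_of_numberField K
  haveI : Countable (Matrix (Fin 3) (Fin 3) K) := inferInstanceAs (Countable (Fin 3 → Fin 3 → K))
  exact Function.Injective.countable Units.val_injective

/-- Every subgroup of `GL₃(K)` is countable for a number field `K` (the arithmetic groups `Γ`). -/
theorem countable_subgroup_GL_of_numberField {K : Type*} [Field K] [NumberField K]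
    (S : Subgroup (GL (Fin 3) K)) : Countable S := by
  haveI := countable_GL_of_numberField K
  infer_instance

/-- The Bergman measure as a measure on the subtype `𝔹²`. -/
noncomputable def bergmanBall : Measure ball₂ := Measure.comap Subtype.val bergmanMeasure

/-- `bergmanBall A = μ_B (A)` for every `A ⊆ 𝔹²`. -/
theorem bergmanBall_apply (A : Set ball₂) : bergmanBall A = bergmanMeasure (Subtype.val '' A) :=
  (MeasurableEmbedding.subtype_coe measurableSet_ball₂).comap_apply _ _

/-- `μ_B (T ∩ 𝔹²) = μ_B T` for measurable `T`: the Bergman measure lives on the ball. -/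
theorem bergmanMeasure_inter_ball₂ {T : Set (Fin 2 → ℂ)} (hT : MeasurableSet T) :
    bergmanMeasure (T ∩ ball₂) = bergmanMeasure T := by
  unfold bergmanMeasure
  rw [withDensity_apply _ (hT.inter measurableSet_ball₂), withDensity_apply _ hT,
    Measure.restrict_restrict (hT.inter measurableSet_ball₂), Measure.restrict_restrict hT,
    Set.inter_assoc, Set.inter_self]

/-- Open non-empty subsets of the ball have positive Bergman measure. -/
theorem bergmanMeasure_pos_of_isOpen {V : Set (Fin 2 → ℂ)} (hV : IsOpen V) (hne : (V ∩ ball₂).Nonempty) :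
    0 < bergmanMeasure (V ∩ ball₂) := by
  unfold bergmanMeasure
  rw [withDensity_apply _ (hV.measurableSet.inter measurableSet_ball₂),
    Measure.restrict_restrict (hV.measurableSet.inter measurableSet_ball₂),
    setLIntegral_pos_iff measurable_volumeDensity.ennreal_ofReal]
  have hsub : V ∩ ball₂ ∩ ball₂ ⊆ Function.support (fun z => ENNReal.ofReal (volumeDensity z)) ∩
      (V ∩ ball₂ ∩ ball₂) := by
    intro z hz
    refine ⟨?_, hz⟩
    rw [Function.mem_support]
    have h1 : 0 < 1 - normSq₂ z := sub_pos.mpr (normSq₂_lt_one hz.2)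
    have h2 : 0 < volumeDensity z := by
      unfold volumeDensity
      positivity
    exact (ENNReal.ofReal_pos.mpr h2).ne'
  refine lt_of_lt_of_le ?_ (measure_mono hsub)
  rw [Set.inter_assoc, Set.inter_self]
  exact (hV.inter isOpen_ball₂).measure_pos volume hne

/-- The Bergman measure on `𝔹²` is positive on open sets. -/
instance isOpenPosMeasure_bergmanBall : bergmanBall.IsOpenPosMeasure := by
  refine ⟨fun U hU hne => ?_⟩
  obtain ⟨V, hV, rfl⟩ := isOpen_induced_iff.mp hU
  rw [bergmanBall_apply, Subtype.image_preimage_coe, Set.inter_comm]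
  obtain ⟨z, hz⟩ := hne
  exact (bergmanMeasure_pos_of_isOpen hV ⟨z, hz, z.property⟩).ne'

section FrameAction

variable {K : Type*} [Field K] [NumberField K] [NumberField.IsCMField K]
    {τ₁ : K →+* ℂ} {H : Matrix (Fin 3) (Fin 3) K} {Q : Matrix (Fin 3) (Fin 3) ℂ}
    (hQ : IsFrame K τ₁ H Q) (S : Subgroup (GL (Fin 3) K)) (hS : (S : Set (GL (Fin 3) K)) ⊆ unitaryGroup K H)

/-- Each element of `S` acts measurably on `𝔹²` (through the frame). -/
theorem measurable_frameAction_smul (γ : S) :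
    letI := frameAction hQ S hS
    Measurable (fun z : ball₂ => γ • z) := by
  letI := frameAction hQ S hS
  exact ((measurable_ballAction (realEmbedding K τ₁ Q (γ : GL (Fin 3) K))).comp
    measurable_subtype_coe).subtype_mk

/-- The frame action of `S` on `𝔹²` is measurable in each group element. -/
theorem measurableConstSMul_frameAction :
    @MeasurableConstSMul S ball₂ (frameAction hQ S hS).toSMul _ := by
  letI := frameAction hQ S hS
  exact ⟨measurable_frameAction_smul hQ S hS⟩

/-- **The Bergman measure on `𝔹²` is `S`-invariant** for the frame action of the arithmetic group. -/
theorem smulInvariantMeasure_bergmanBall :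
    @SMulInvariantMeasure S ball₂ (frameAction hQ S hS).toSMul _ bergmanBall := by
  letI := frameAction hQ S hS
  refine ⟨fun γ A hA => ?_⟩
  have hg : IsInU21 (realEmbedding K τ₁ Q (γ : GL (Fin 3) K)) :=
    IsFrame.isInU21_realEmbedding hQ (hS γ.property)
  have hAm : MeasurableSet (Subtype.val '' A) :=
    (MeasurableEmbedding.subtype_coe measurableSet_ball₂).measurableSet_image.mpr hA
  rw [bergmanBall_apply, bergmanBall_apply]
  have himg : Subtype.val '' ((fun z : ball₂ => γ • z) ⁻¹' A) =
      (ballAction (realEmbedding K τ₁ Q (γ : GL (Fin 3) K))) ⁻¹' (Subtype.val '' A) ∩ ball₂ := by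
    ext w
    constructor
    · rintro ⟨z, hz, rfl⟩
      refine ⟨⟨γ • z, hz, (frameAction_smul_coe hQ S hS γ z).symm⟩, z.property⟩
    · rintro ⟨⟨u, hu, huw⟩, hw⟩
      refine ⟨⟨w, hw⟩, ?_, rfl⟩
      show γ • (⟨w, hw⟩ : ball₂) ∈ A
      have : γ • (⟨w, hw⟩ : ball₂) = u := Subtype.ext (by rw [frameAction_smul_coe]; exact huw.symm)
      rw [this]
      exact hu
  rw [himg, bergmanMeasure_inter_ball₂ ((measurable_ballAction _) hAm),
    ← Measure.map_apply (measurable_ballAction _) hAm, map_ballAction_bergmanMeasure hg]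

/-- «`D` is a fundamental domain for the frame action of `S` on `𝔹²`» (Mathlib's `IsFundamentalDomain`
with respect to the Bergman measure). -/
def IsBallFundamentalDomain (D : Set ball₂) : Prop :=
  @IsFundamentalDomain S ball₂ _ (frameAction hQ S hS).toSMul _ D bergmanBall

/-- The quotient measure on `Γ\𝔹²`: the push-forward of `μ_B|_D` along `mk`. -/
noncomputable def quotientMeasure (D : Set ball₂) : Measure (ballQuotient hQ S hS) :=
  Measure.map (ballQuotient.mk hQ S hS) (bergmanBall.restrict D)

/-- `mk` is measurable for the quotient σ-algebra. -/
theorem measurable_ballQuotient_mk : Measurable (ballQuotient.mk hQ S hS) := measurable_quotient_mk''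

/-- Every open subset of `Γ\𝔹²` is measurable. -/
instance opensMeasurableSpace_ballQuotient : OpensMeasurableSpace (ballQuotient hQ S hS) := by
  refine ⟨MeasurableSpace.generateFrom_le fun U hU => ?_⟩
  rw [measurableSet_quotient]
  exact ((isOpenQuotientMap_ballQuotient_mk hQ S hS).continuous.isOpen_preimage U hU).measurableSet

/-- The quotient measure of a measurable set is the Bergman measure of its preimage in `D`. -/
theorem quotientMeasure_apply (D : Set ball₂) {A : Set (ballQuotient hQ S hS)} (hA : MeasurableSet A) :
    quotientMeasure hQ S hS D A = bergmanBall (ballQuotient.mk hQ S hS ⁻¹' A ∩ D) := by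
  unfold quotientMeasure
  rw [Measure.map_apply (measurable_ballQuotient_mk hQ S hS) hA,
    Measure.restrict_apply (measurable_ballQuotient_mk hQ S hS hA)]

/-- **The quotient measure is the measure of the fundamental domain** (Mathlib's
`QuotientMeasureEqMeasurePreimage`): for a fundamental domain `D`, `quotientMeasure D` is the canonical
measure on `Γ\𝔹²` induced by `μ_B`. -/
theorem quotientMeasureEqMeasurePreimage_quotientMeasure {D : Set ball₂}
    (hD : IsBallFundamentalDomain hQ S hS D) :
    letI := frameAction hQ S hS
    QuotientMeasureEqMeasurePreimage bergmanBall (quotientMeasure hQ S hS D) := by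
  letI := frameAction hQ S hS
  haveI : MeasurableConstSMul S ball₂ := measurableConstSMul_frameAction hQ S hS
  haveI : SMulInvariantMeasure S ball₂ bergmanBall := smulInvariantMeasure_bergmanBall hQ S hS
  haveI : Countable S := countable_subgroup_GL_of_numberField S
  exact hD.quotientMeasureEqMeasurePreimage_quotientMeasure

/-- Lower integrals over `Γ\𝔹²` are lower integrals over the fundamental domain. -/
theorem lintegral_quotientMeasure (D : Set ball₂) {φ : ballQuotient hQ S hS → ENNReal}
    (hφ : Measurable φ) :
    ∫⁻ x, φ x ∂quotientMeasure hQ S hS D = ∫⁻ z in D, φ (ballQuotient.mk hQ S hS z) ∂bergmanBall := by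
  unfold quotientMeasure
  rw [lintegral_map hφ (measurable_ballQuotient_mk hQ S hS)]

/-- Integrals over `Γ\𝔹²` are integrals over the fundamental domain. -/
theorem integral_quotientMeasure (D : Set ball₂) {F : Type*} [NormedAddCommGroup F] [NormedSpace ℝ F]
    {φ : ballQuotient hQ S hS → F} (hφ : AEStronglyMeasurable φ (quotientMeasure hQ S hS D)) :
    ∫ x, φ x ∂quotientMeasure hQ S hS D = ∫ z in D, φ (ballQuotient.mk hQ S hS z) ∂bergmanBall := by
  unfold quotientMeasure at hφ ⊢
  rw [integral_map (measurable_ballQuotient_mk hQ S hS).aemeasurable hφ]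

/-- The preimage in `𝔹²` of a subset of `Γ\𝔹²` is `S`-invariant (pointwise form). -/
theorem smul_mem_preimage_mk_iff (A : Set (ballQuotient hQ S hS)) (γ : S) (z : ball₂) :
    letI := frameAction hQ S hS
    γ • z ∈ ballQuotient.mk hQ S hS ⁻¹' A ↔ z ∈ ballQuotient.mk hQ S hS ⁻¹' A := by
  letI := frameAction hQ S hS
  rw [Set.mem_preimage, Set.mem_preimage]
  have : ballQuotient.mk hQ S hS (γ • z) = ballQuotient.mk hQ S hS z :=
    Quotient.sound ⟨γ, rfl⟩
  rw [this]

/-- **The quotient measure is positive on open sets** (for a fundamental domain `D`): an open non-empty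
`U ⊆ Γ\𝔹²` has open, non-empty, `S`-invariant preimage, which meets `D` in positive measure. -/
theorem isOpenPosMeasure_quotientMeasure {D : Set ball₂} (hD : IsBallFundamentalDomain hQ S hS D) :
    (quotientMeasure hQ S hS D).IsOpenPosMeasure := by
  letI := frameAction hQ S hS
  haveI : SMulInvariantMeasure S ball₂ bergmanBall := smulInvariantMeasure_bergmanBall hQ S hS
  haveI : MeasurableConstSMul S ball₂ := measurableConstSMul_frameAction hQ S hS
  haveI : Countable S := countable_subgroup_GL_of_numberField S
  refine ⟨fun U hU hne => ?_⟩
  rw [quotientMeasure_apply hQ S hS D hU.measurableSet]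
  intro h0
  have hUo : IsOpen (ballQuotient.mk hQ S hS ⁻¹' U) :=
    (isOpenQuotientMap_ballQuotient_mk hQ S hS).continuous.isOpen_preimage U hU
  have hUne : (ballQuotient.mk hQ S hS ⁻¹' U).Nonempty := by
    obtain ⟨x, hx⟩ := hne
    obtain ⟨z, rfl⟩ := ballQuotient_mk_surjective hQ S hS x
    exact ⟨z, hx⟩
  have hinv : ∀ γ : S, γ • (ballQuotient.mk hQ S hS ⁻¹' U) = ballQuotient.mk hQ S hS ⁻¹' U := by
    intro γ
    ext z
    rw [Set.mem_smul_set_iff_inv_smul_mem]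
    exact smul_mem_preimage_mk_iff hQ S hS U γ⁻¹ z
  have := hD.measure_zero_of_invariant _ hinv h0
  exact (hUo.measure_pos bergmanBall hUne).ne' this

/-- The total mass of the quotient measure is the Bergman measure of `D`. -/
theorem quotientMeasure_univ (D : Set ball₂) : quotientMeasure hQ S hS D Set.univ = bergmanBall D := by
  rw [quotientMeasure_apply hQ S hS D MeasurableSet.univ, Set.preimage_univ, Set.univ_inter]

/-- The quotient measure is finite as soon as the fundamental domain has finite Bergman measure. -/
theorem isFiniteMeasure_quotientMeasure (D : Set ball₂) (hfin : bergmanBall D < ⊤) :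
    IsFiniteMeasure (quotientMeasure hQ S hS D) :=
  ⟨by rw [quotientMeasure_univ]; exact hfin⟩

end FrameAction

end Summit.Ventures.HodgeRepro2.ShimuraData
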